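import Literature.Topology.FourManifolds.SliceDiscOfConcordance
import Literature.Topology.FourManifolds.ConcordanceOfFlatSliceDisc
import Literature.Topology.FourManifolds.SliceDiscFlattening
import HarnessLib

/-!
# A knot is smoothly slice iff it is concordant to the unknot (discharge)

Sibling proof file of `Literature/Topology/FourManifolds/SliceRibbon.lean`: **discharge** of its
named fact `Literature.Topology.FourManifolds.Knot.isSmoothlySlice_iff_isConcordant_unknot`
(R. H. Fox, J. W. Milnor, *Singularities of 2-spheres in 4-space and cobordism of knots*, Osaka J.
Math. 3 (1966), §3, Thm. 3 and p. 265: the identity of the knot cobordism group is the class of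
slice knots; C. Livingston, *A survey of classical knot concordance* (2005), §1: "a knot
represents the trivial element in this group if it is slice") as
`Literature.Topology.FourManifolds.Knot.isSmoothlySlice_iff_isConcordant_unknot_holds`, by
assembling the three proved bricks of the tree:

* `Knot.IsSmoothlySlice.exists_isSliceDisc_flat` (`SliceDiscFlattening.lean`): a slice disc may be
  taken flat near its centre;
* `Knot.IsSliceDisc.isConcordant_unknot_of_flat` (`ConcordanceOfFlatSliceDisc.lean`): puncturing a
  flat-centred slice disc gives a concordance to the unknot;
* `Knot.IsConcordant.isSmoothlySlice_of_unknot` (`SliceDiscOfConcordance.lean`): capping a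
  concordance to the unknot gives a slice disc.

## References

* R. H. Fox, J. W. Milnor, Osaka J. Math. 3 (1966) 257–267, §3, Thm. 3 (p. 265). [FoxMilnor1966]
* C. Livingston, *A survey of classical knot concordance*, Handbook of knot theory (2005), §1,
  §2.1 (held: arXiv math/0307077, p. 2). [Livingston2005]

## Design notes

No definitions, no named facts, no `sorry`, no instances, no notation.
-/

namespace Literature.Topology.FourManifolds

namespace Knot

/-- **Discharge of the named fact `Knot.isSmoothlySlice_iff_isConcordant_unknot`** (Fox–Milnor):
a knot is smoothly slice (`Knot.IsSmoothlySlice`: bounds a neat smooth slice disc in `B⁴`) iff it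
is concordant to the unknot (`Knot.IsConcordant K unknot`). Forward: flatten a slice disc near its
centre (`IsSmoothlySlice.exists_isSliceDisc_flat`) and puncture it
(`IsSliceDisc.isConcordant_unknot_of_flat`); backward: cap the concordance off
(`IsConcordant.isSmoothlySlice_of_unknot`). Fox–Milnor (1966), §3, Thm. 3 and p. 265; Livingston
(2005), §1. [cite: FoxMilnor1966, §3 Thm. 3] -/
theorem isSmoothlySlice_iff_isConcordant_unknot_holds : isSmoothlySlice_iff_isConcordant_unknot := by
  intro _ K
  constructor
  · intro h
    obtain ⟨g, ρ, hg, hρ, hρ2, hflat⟩ := h.exists_isSliceDisc_flat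
    exact hg.isConcordant_unknot_of_flat hρ hρ2 hflat
  · exact IsConcordant.isSmoothlySlice_of_unknot

end Knot

end Literature.Topology.FourManifolds
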